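/-
Copyright (c) 2026 the pub-hodgecm-mathlib formalisation cell (harness21).  Prover seat hodgecm-mathlib-K2-defs1 (g6), Track B, h413 = `stmt-HodgeConjecture-24833`, route `HCCMUnconditional`,
campaign «5Res (b) BL-2(χ,τ)», SHEET row 12a (dealer K2E1-plan (g6) (117) 2026-09-04T11:03:50Z; REPORT-FIRST 11:05Z).
-/
import Summits.HodgeConjecture.HodgeConjecture.Theorems.K2E1BLUniquenessSelfAdjointU2   -- ★ P6′ (this seat ∕ K2E1-p09): `isSelfAdjoint_integratedOperator_rightRegular_of_symm`, `exists_memLp_toLp_eq_integratedOperator_of_ae_eq`, `absolutelyContinuous_withDensity_weightX`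
import Mathlib.LinearAlgebra.Eigenspace.Triangularizable
import HarnessLib

/-!
# 5Res (b) row 12a — `K2E1ChiEisensteinUniquenessU2`: the «L² + SELF-ADJOINT» UNIQUENESS for the (χ,τ) 𝔛-system — a homogeneous solution `Ψ′ : V →ₗ 𝓗_k(𝔛)` with `T_{i₀} ∘ Ψ′ = Ψ′ ∘ 𝔥_{i₀}(z)`,
# `L²` values, and a Hecke MATRIX `𝔥_{i₀}(z)` WITHOUT REAL EIGENVALUES vanishes (the (χ,τ)-twin of P5c∕P6′ ★ `hunq_of_memLp_of_lt`, rank-generic, point-wise in `z`)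

Cell `pub/hodgecm-mathlib`, crux H413 = `stmt-HodgeConjecture-24833`.  THEOREMS ONLY (no `def`, no `instance`, no notation, no named-fact hypothesis, no `sorry`); lane `--supports
stmt-HodgeConjecture-24833 --as helper` (count-neutral).  Closes no socket.  Generic `(F, E, c, N)`, abstract finite-dimensional `V` (consumers: `V = ↥(chiSectionSpace χ K′ ω)`, ★ row 9).

THE MATHEMATICS ([BernsteinLapid2019, §4 Claim 2, Thm 2.3]; [MoeglinWaldspurger1995, IV.1.9]).  In the (χ,τ) 𝔛-system the unknown is the LINEAR MAP `Ψ : V → X = 𝓗_k(𝔛)`, `φ ↦ [Ẽ(f_z^φ)]` (`V` the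
finite-dimensional section space), and the Hecke clause reads `T_i ∘ Ψ = Ψ ∘ 𝔥_i(z)` with the Hecke MATRIX `𝔥_i(z) ∈ End V` of ★ row 10 (`R(h)E(f_z^φ) = E(f_z^{𝔥(z)φ})`).  Two solutions differ by a
HOMOGENEOUS solution `Ψ′` (`T_{i₀} ∘ Ψ′ = Ψ′ ∘ 𝔥_{i₀}(z)`, constant terms in `V′_{1−z}`, `QΨ′ = 0`), whose values are in `L²(μ)` (the `L²`-letter, as in the spherical (i)).  §1 (Mathlib only) THE
LINEAR-ALGEBRA LEMMA replacing «`Im ĥ(z) ≠ 0` kills an eigenvector of a self-adjoint operator»: if `S` is SYMMETRIC on an inner-product space `H`, `A ∈ End V` (`V` finite-dimensional over `ℂ`)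
has NO REAL EIGENVALUE, and `L : V →ₗ H` intertwines (`S ∘ L = L ∘ A`), then `L = 0` — `W := range L` is finite-dimensional and `S`-stable; if `W ≠ 0`, `S|_W` has an eigenvalue (ℂ algebraically
closed), REAL by symmetry, so `(S − μ)|_W` is not injective hence not surjective, while `(S − μ) ∘ L = L ∘ (A − μ)` with `A − μ` onto forces `(S − μ)W = W`.  §2 THE HEAD: with `S = R(h_{i₀})` on
`L²(G(F)∖G(𝔸), μ)` (self-adjoint for the symmetric real `h_{i₀} = η^∨ ∗ η`, ★ P6′ §1.1), `T_{i₀}` of P3-C's shape (★ `exists_shiftOperatorX`, moved to `L²`-classes by the ★ bridge), and the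
`L²`-letter, a homogeneous `Ψ′` with `𝔥_{i₀}(z)` free of real eigenvalues is `0`.  The separation «`𝔥_{i₀}(z)` has no real eigenvalue on a non-empty open `U₀`» (the twin of ★ `uniqueSetSA_nonempty`,
`Im ĥ ≠ 0`) is the letter `hsep` of row 12c; spherical sanity: `V = ℂ`, `𝔥 = ĥ(z)·1`, no real eigenvalue ⟺ `Im ĥ(z) ≠ 0`.
* §1 `surjective_sub_smul_of_forall_not_hasEigenvalue`, **`eq_zero_of_isSymmetric_of_comp_eq`**, `forall_not_hasEigenvalue_smul_one_iff` (spherical sanity).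
* §2 `exists_linearMap_toLp` (the `L²`-class map `Λ : V →ₗ L²(μ)` of an `L²`-valued `Ψ′`), **`homogeneous_eq_zero_of_memLp`** (HEAD, point-wise in `z`), `homogeneous_eq_zero_of_memLp_on` (on a set `U₀` of the letter `hsep`).
HONEST LABEL: HC_CM is proved only modulo the 7 printed citations (2 remaining named inputs: hLiu418 = `stmt-HodgeConjecture-24832`, h413 = `stmt-HodgeConjecture-24833`) until rung 0
closes; count-neutral helper, closes no socket.

## References
* [BernsteinLapid2019] J. Bernstein, E. Lapid, *On the meromorphic continuation of Eisenstein series*, J. Amer. Math. Soc. 37 (2024) (arXiv:1911.02342), §4 Claim 2 (p. 9), Thm 2.3.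
* [MoeglinWaldspurger1995] C. Mœglin, J.-L. Waldspurger, *Spectral Decomposition and Eisenstein Series* (1995), IV.1.9.
* S. Axler, *Linear Algebra Done Right*, 3rd ed. (2015), 7.13 (eigenvalues of self-adjoint operators are real), 5.21 (existence of eigenvalues over `ℂ`) — folklore linear algebra of §1.
-/

set_option autoImplicit false
-- the mandated namespace repeats the single-problem summit's segment (`HodgeConjecture.HodgeConjecture`)
set_option linter.dupNamespace false

noncomputable section

open MeasureTheory MeasureTheory.Measure Set NumberField IsDedekindDomain Filter Topology
open scoped NNReal ENNReal InnerProductSpace ComplexConjugate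
open Literature.NumberTheory.Automorphic Literature.NumberTheory.Automorphic.UnitaryGroup AdelicGroupData
open Summit.HodgeConjecture.HodgeConjecture.Cruxes.H413.K2E1BLBorelSpacesU2Defs
open Summit.HodgeConjecture.HodgeConjecture.Cruxes.H413.K2E1BLBorelOperatorsU2Defs
open Summit.HodgeConjecture.HodgeConjecture.Cruxes.H413.K2E1BLUniquenessSelfAdjointU2 (isSelfAdjoint_integratedOperator_rightRegular_of_symm exists_memLp_toLp_eq_integratedOperator_of_ae_eq absolutelyContinuous_withDensity_weightX)

namespace Summit.HodgeConjecture.HodgeConjecture.Cruxes.H413.K2E1ChiEisensteinUniquenessU2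

/-! ## §1 Linear algebra: a symmetric operator cannot intertwine a matrix without real eigenvalues -/

section LinearAlgebra

variable {V : Type*} [AddCommGroup V] [Module ℂ V] [FiniteDimensional ℂ V]

/-- On a finite-dimensional `V`, if the real number `r` is not an eigenvalue of `A` then `A − r` is onto (injective ⟺ surjective). [folklore] -/
theorem surjective_sub_smul_of_forall_not_hasEigenvalue (A : Module.End ℂ V) (hA : ∀ r : ℝ, ¬ A.HasEigenvalue (r : ℂ)) (r : ℝ) :
    Function.Surjective (A - ((r : ℂ) • LinearMap.id : V →ₗ[ℂ] V)) := by
  refine LinearMap.injective_iff_surjective.1 ((injective_iff_map_eq_zero _).2 fun v hv => ?_)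
  by_contra hne
  refine hA r (Module.End.hasEigenvalue_of_hasEigenvector ⟨Module.End.mem_eigenspace_iff.2 ?_, hne⟩)
  rw [LinearMap.sub_apply, LinearMap.smul_apply, LinearMap.id_apply, sub_eq_zero] at hv
  exact hv

/-- **A SYMMETRIC OPERATOR CANNOT INTERTWINE A MATRIX WITHOUT REAL EIGENVALUES**: `S` symmetric on an inner-product space `H`, `A ∈ End V` (`dim V < ∞`) with no real eigenvalue, `L : V →ₗ H` with
`S (L v) = L (A v)` for all `v` ⟹ `L = 0`.  (`W = range L` is finite-dimensional and `S`-stable; an eigenvalue `μ` of `S|_W` exists if `W ≠ 0` and is real; `(S − μ)|_W` is then not injective, hence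
not surjective, contradicting `(S − μ) ∘ L = L ∘ (A − μ)` with `A − μ` onto.) [folklore] [cite: BernsteinLapid2019, §4 Claim 2 (p. 9)] -/
theorem eq_zero_of_isSymmetric_of_comp_eq {H : Type*} [NormedAddCommGroup H] [InnerProductSpace ℂ H] (A : Module.End ℂ V) {S : H →ₗ[ℂ] H} (hS : S.IsSymmetric)
    (L : V →ₗ[ℂ] H) (hint : ∀ v, S (L v) = L (A v)) (hA : ∀ r : ℝ, ¬ A.HasEigenvalue (r : ℂ)) : L = 0 := by
  classical
  by_contra hL
  set W : Submodule ℂ H := LinearMap.range L with hWdef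
  have hSW : ∀ w ∈ W, S w ∈ W := by
    rintro _ ⟨v, rfl⟩
    exact ⟨A v, (hint v).symm⟩
  haveI : FiniteDimensional ℂ ↥W := LinearMap.finiteDimensional_range L
  haveI : Nontrivial ↥W := (Submodule.nontrivial_iff_ne_bot).2 fun h => hL (LinearMap.range_eq_bot.1 h)
  set SW : ↥W →ₗ[ℂ] ↥W := S.restrict hSW with hSWdef
  have hSWsymm : SW.IsSymmetric := fun x y => by
    rw [Submodule.coe_inner, Submodule.coe_inner, hSWdef, LinearMap.coe_restrict_apply, LinearMap.coe_restrict_apply]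
    exact hS _ _
  obtain ⟨μ, hμ⟩ := Module.End.exists_eigenvalue SW
  have hμre : ((μ.re : ℝ) : ℂ) = μ := Complex.conj_eq_iff_re.1 (hSWsymm.conj_eigenvalue_eq_self hμ)
  obtain ⟨w, hw⟩ := hμ.exists_hasEigenvector
  set D : ↥W →ₗ[ℂ] ↥W := SW - (μ.re : ℂ) • LinearMap.id with hDdef
  have hDw : D w = 0 := by
    rw [hDdef, LinearMap.sub_apply, LinearMap.smul_apply, LinearMap.id_apply, Module.End.mem_eigenspace_iff.1 hw.1, hμre, sub_self]
  have hDsurj : Function.Surjective D := by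
    intro y
    obtain ⟨v, hv⟩ := y.2
    obtain ⟨v', hv'⟩ := surjective_sub_smul_of_forall_not_hasEigenvalue A hA μ.re v
    refine ⟨⟨L v', ⟨v', rfl⟩⟩, Subtype.ext ?_⟩
    rw [hDdef, LinearMap.sub_apply, LinearMap.smul_apply, LinearMap.id_apply, Submodule.coe_sub, Submodule.coe_smul, hSWdef, LinearMap.coe_restrict_apply,
      hint v', ← hv, ← hv', LinearMap.sub_apply, LinearMap.smul_apply, LinearMap.id_apply, map_sub, map_smul]
  exact hw.2 ((LinearMap.injective_iff_surjective.2 hDsurj) (hDw.trans (map_zero D).symm))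

omit [FiniteDimensional ℂ V] in
/-- **Spherical sanity**: for the scalar matrix `a·1` on a non-trivial `V`, «no real eigenvalue» ⟺ `Im a ≠ 0` — ★ P6′'s separation `Im ĥ_{i₀}(z) ≠ 0` is the `dim V = 1` case of `hsep`. [cite: BernsteinLapid2019, §4 Claim 2 (p. 9)] -/
theorem forall_not_hasEigenvalue_smul_one_iff [Nontrivial V] (a : ℂ) :
    (∀ r : ℝ, ¬ Module.End.HasEigenvalue (a • (1 : Module.End ℂ V)) (r : ℂ)) ↔ a.im ≠ 0 := by
  have key : ∀ r : ℂ, Module.End.HasEigenvalue (a • (1 : Module.End ℂ V)) r ↔ r = a := fun r => by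
    constructor
    · intro h
      obtain ⟨v, hv⟩ := h.exists_hasEigenvector
      have h1 := Module.End.mem_eigenspace_iff.1 hv.1
      rw [LinearMap.smul_apply, Module.End.one_apply] at h1
      exact (smul_left_injective ℂ hv.2 h1).symm
    · rintro rfl
      obtain ⟨v, hv⟩ := exists_ne (0 : V)
      exact Module.End.hasEigenvalue_of_hasEigenvector ⟨Module.End.mem_eigenspace_iff.2 (by rw [LinearMap.smul_apply, Module.End.one_apply]), hv⟩
  simp only [key]
  constructor
  · intro h him
    exact h a.re (Complex.ext (by simp) (by simp [him]))
  · rintro him r hr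
    rw [← hr] at him
    exact him (Complex.ofReal_im r)

end LinearAlgebra

/-! ## §2 The head: a homogeneous (χ,τ)-solution with `L²` values and a Hecke matrix without real eigenvalues vanishes -/

section Head

variable {F E : Type} [Field F] [NumberField F] [Field E] [NumberField E] [Algebra F E] {c : E ≃ₐ[F] E} {N : ℕ} [NeZero N]
variable [MeasurableSpace (quasiSplit F E c N).Adelic] [BorelSpace (quasiSplit F E c N).Adelic]
variable (μ : Measure (quasiSplit F E c N).automorphicQuotient) [(quasiSplit F E c N).IsAutomorphicMeasure μ]
variable (νG : Measure (quasiSplit F E c N).Adelic) [νG.IsHaarMeasure] [νG.IsInvInvariant] (k : ℕ)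

omit [MeasurableSpace (quasiSplit F E c N).Adelic] [BorelSpace (quasiSplit F E c N).Adelic] [(quasiSplit F E c N).IsAutomorphicMeasure μ] in
/-- **THE `L²`-CLASS MAP OF AN `L²`-VALUED LINEAR MAP**: for `Ψ : V →ₗ 𝓗_k(𝔛)` with every value in `L²(μ)`, `φ ↦ [Ψ φ] ∈ L²(μ)` is linear (a.e. identities of ★ `Lp.coeFn_add ∕ _smul` moved from
`w₁^{−2k}μ` to `μ`, ★ `absolutelyContinuous_withDensity_weightX`). [cite: BernsteinLapid2019, §4 p. 10] -/
theorem exists_linearMap_toLp {V : Type*} [AddCommGroup V] [Module ℂ V] (Ψ : V →ₗ[ℂ] HX F E c N k μ)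
    (hL2 : ∀ φ : V, MemLp ((Ψ φ : HX F E c N k μ) : (quasiSplit F E c N).automorphicQuotient → ℂ) 2 μ) :
    ∃ Λ : V →ₗ[ℂ] (quasiSplit F E c N).L2 μ, ∀ φ : V, Λ φ = (hL2 φ).toLp _ := by
  have hμw := absolutelyContinuous_withDensity_weightX (F := F) (E := E) (c := c) (N := N) μ k
  refine ⟨{ toFun := fun φ => (hL2 φ).toLp _, map_add' := fun φ ψ => ?_, map_smul' := fun a φ => ?_ }, fun φ => rfl⟩
  · rw [← MemLp.toLp_add (hL2 φ) (hL2 ψ)]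
    refine (MemLp.toLp_eq_toLp_iff (hL2 (φ + ψ)) ((hL2 φ).add (hL2 ψ))).2 ?_
    have h1 : ((Ψ (φ + ψ) : HX F E c N k μ) : (quasiSplit F E c N).automorphicQuotient → ℂ)
        =ᵐ[μ.withDensity fun x => (((supHeight F E c N x)⁻¹ ^ (2 * k) : ℝ≥0) : ℝ≥0∞)]
          ((Ψ φ : HX F E c N k μ) : (quasiSplit F E c N).automorphicQuotient → ℂ) + ((Ψ ψ : HX F E c N k μ) : (quasiSplit F E c N).automorphicQuotient → ℂ) := by
      rw [map_add]; exact Lp.coeFn_add _ _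
    exact h1.filter_mono hμw.ae_le
  · rw [RingHom.id_apply, ← MemLp.toLp_const_smul]
    refine (MemLp.toLp_eq_toLp_iff (hL2 (a • φ)) ((hL2 φ).const_smul a)).2 ?_
    have h1 : ((Ψ (a • φ) : HX F E c N k μ) : (quasiSplit F E c N).automorphicQuotient → ℂ)
        =ᵐ[μ.withDensity fun x => (((supHeight F E c N x)⁻¹ ^ (2 * k) : ℝ≥0) : ℝ≥0∞)] a • ((Ψ φ : HX F E c N k μ) : (quasiSplit F E c N).automorphicQuotient → ℂ) := by
      rw [map_smul]; exact Lp.coeFn_smul _ _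
    exact h1.filter_mono hμw.ae_le

/-- **ROW 12a HEAD — A HOMOGENEOUS (χ,τ)-SOLUTION WITH `L²` VALUES AND A HECKE MATRIX WITHOUT REAL EIGENVALUES VANISHES** (rank-generic, point-wise in `z`).  Data: `X = 𝓗_k(𝔛)` for an
automorphic `μ`, an inversion-invariant Haar `νG`; ONE symmetric real test function `h` (`h(g⁻¹) = h(g) = conj h(g)`, continuous of compact support: the amended spec `h = η^∨ ∗ η`) with its
`𝓗_k(𝔛)`-operator `T` of P3-C's shape (letter `hT`, ★ `exists_shiftOperatorX`); a finite-dimensional `V` with an endomorphism `𝔥` (the Hecke MATRIX of `h` at the point `z`, ★ row 10) having NO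
REAL EIGENVALUE (letter `hsep` of row 12c at `z`); a linear `Ψ : V →ₗ X` with `T (Ψ φ) = Ψ (𝔥 φ)` (the Hecke clause of the difference of two solutions) and every `Ψ φ ∈ L²(μ)` (the `L²`-letter, as
★ P6′ item (i)).  THEN `Ψ = 0`: the `L²`-classes `Λ φ = [Ψ φ]` form a linear map intertwining `𝔥` with the SELF-ADJOINT `R(h)` (★ P6′ §1.1 + the ★ `L²`-bridge), so `Λ = 0` by §1, and `μ`,
`w₁^{−2k}μ` are mutually absolutely continuous. [cite: BernsteinLapid2019, §4 Claim 2 (p. 9), Thm 2.3] [cite: MoeglinWaldspurger1995, IV.1.9] -/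
theorem homogeneous_eq_zero_of_memLp {h : (quasiSplit F E c N).Adelic → ℂ} (hhc : Continuous h) (hhs : HasCompactSupport h)
    (hsymm : ∀ g, h g⁻¹ = h g) (hreal : ∀ g, conj (h g) = h g)
    (T : HX F E c N k μ →L[ℂ] HX F E c N k μ)
    (hT : ∀ u : HX F E c N k μ, ((T u : HX F E c N k μ) : (quasiSplit F E c N).automorphicQuotient → ℂ) =ᵐ[μ.withDensity fun x => (((supHeight F E c N x)⁻¹ ^ (2 * k) : ℝ≥0) : ℝ≥0∞)]
      fun ξ => ∫ y, h y * (u : (quasiSplit F E c N).automorphicQuotient → ℂ) (y⁻¹ • ξ) ∂νG)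
    {V : Type*} [AddCommGroup V] [Module ℂ V] [FiniteDimensional ℂ V] (𝔥 : Module.End ℂ V) (hsep : ∀ r : ℝ, ¬ 𝔥.HasEigenvalue (r : ℂ))
    (Ψ : V →ₗ[ℂ] HX F E c N k μ) (hΨT : ∀ φ : V, T (Ψ φ) = Ψ (𝔥 φ))
    (hL2 : ∀ φ : V, MemLp ((Ψ φ : HX F E c N k μ) : (quasiSplit F E c N).automorphicQuotient → ℂ) 2 μ) : Ψ = 0 := by
  haveI : SecondCountableTopology (quasiSplit F E c N).Adelic := inferInstanceAs (SecondCountableTopology (adelic F E c N ((StdForm.antidiagonal N).over E)))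
  haveI : LocallyCompactSpace (quasiSplit F E c N).Adelic := inferInstanceAs (LocallyCompactSpace (adelic F E c N ((StdForm.antidiagonal N).over E)))
  obtain ⟨Λ, hΛ⟩ := exists_linearMap_toLp μ k Ψ hL2
  set R : (quasiSplit F E c N).L2 μ →L[ℂ] (quasiSplit F E c N).L2 μ := ((quasiSplit F E c N).rightRegular μ).integratedOperator ((quasiSplit F E c N).isUnitary_rightRegular μ)
    ((quasiSplit F E c N).isStronglyContinuous_rightRegular_holds μ) νG ⟨⟨h, hhc⟩, hhs⟩ with hR
  have hRsymm : (R : (quasiSplit F E c N).L2 μ →ₗ[ℂ] (quasiSplit F E c N).L2 μ).IsSymmetric :=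
    (isSelfAdjoint_integratedOperator_rightRegular_of_symm (quasiSplit F E c N) μ νG ⟨⟨h, hhc⟩, hhs⟩ hsymm hreal).isSymmetric
  -- `R (Λ φ) = Λ (𝔥 φ)`: the ★ bridge turns `T` into `R(h)` on `L²`-classes
  have hint : ∀ φ : V, (R : (quasiSplit F E c N).L2 μ →ₗ[ℂ] (quasiSplit F E c N).L2 μ) (Λ φ) = Λ (𝔥 φ) := fun φ => by
    obtain ⟨hTv, hcomp⟩ := exists_memLp_toLp_eq_integratedOperator_of_ae_eq μ νG k hhc hhs T hT (Ψ φ) (hL2 φ)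
    rw [ContinuousLinearMap.coe_coe, hΛ φ, hR, ← hcomp, hΛ (𝔥 φ)]
    exact (MemLp.toLp_eq_toLp_iff hTv (hL2 (𝔥 φ))).2 (Eventually.of_forall fun x => by rw [hΨT φ])
  have hΛ0 : Λ = 0 := eq_zero_of_isSymmetric_of_comp_eq 𝔥 hRsymm Λ hint hsep
  -- back to `X`
  have hwμ : (μ.withDensity fun x => (((supHeight F E c N x)⁻¹ ^ (2 * k) : ℝ≥0) : ℝ≥0∞)) ≪ μ := withDensity_absolutelyContinuous μ _
  refine LinearMap.ext fun φ => ?_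
  have h0 : (hL2 φ).toLp _ = 0 := by rw [← hΛ φ, hΛ0, LinearMap.zero_apply]
  have hae0 : ((Ψ φ : HX F E c N k μ) : (quasiSplit F E c N).automorphicQuotient → ℂ) =ᵐ[μ] 0 := by
    have h1 := MemLp.coeFn_toLp (hL2 φ)
    rw [h0] at h1
    exact ((Lp.coeFn_zero ℂ 2 μ).symm.trans h1).symm
  rw [LinearMap.zero_apply]
  exact Lp.eq_zero_iff_ae_eq_zero.2 (hae0.filter_mono hwμ.ae_le)

/-- **ROW 12a HEAD ON A SET** (the shape 12b consumes): on any set `U₀` on which the Hecke matrices `𝔥 z` of the symmetric real `h` have no real eigenvalue (letter `hsep`, row 12c) and the homogeneous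
solutions have `L²` values (letter `hL2`, the (χ,τ)-twin of ★ `hL2_cm_two`), every homogeneous solution of the (χ,τ) 𝔛-system vanishes. [cite: BernsteinLapid2019, §4 Claim 2 (p. 9), Thm 2.3] -/
theorem homogeneous_eq_zero_of_memLp_on {h : (quasiSplit F E c N).Adelic → ℂ} (hhc : Continuous h) (hhs : HasCompactSupport h)
    (hsymm : ∀ g, h g⁻¹ = h g) (hreal : ∀ g, conj (h g) = h g)
    (T : HX F E c N k μ →L[ℂ] HX F E c N k μ)
    (hT : ∀ u : HX F E c N k μ, ((T u : HX F E c N k μ) : (quasiSplit F E c N).automorphicQuotient → ℂ) =ᵐ[μ.withDensity fun x => (((supHeight F E c N x)⁻¹ ^ (2 * k) : ℝ≥0) : ℝ≥0∞)]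
      fun ξ => ∫ y, h y * (u : (quasiSplit F E c N).automorphicQuotient → ℂ) (y⁻¹ • ξ) ∂νG)
    {V : Type*} [AddCommGroup V] [Module ℂ V] [FiniteDimensional ℂ V] (𝔥 : ℂ → Module.End ℂ V) {U₀ : Set ℂ} (hsep : ∀ z ∈ U₀, ∀ r : ℝ, ¬ (𝔥 z).HasEigenvalue (r : ℂ))
    (hL2 : ∀ z ∈ U₀, ∀ Ψ : V →ₗ[ℂ] HX F E c N k μ, (∀ φ : V, T (Ψ φ) = Ψ (𝔥 z φ)) →
      ∀ φ : V, MemLp ((Ψ φ : HX F E c N k μ) : (quasiSplit F E c N).automorphicQuotient → ℂ) 2 μ) :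
    ∀ z ∈ U₀, ∀ Ψ : V →ₗ[ℂ] HX F E c N k μ, (∀ φ : V, T (Ψ φ) = Ψ (𝔥 z φ)) → Ψ = 0 :=
  fun z hz Ψ hΨT => homogeneous_eq_zero_of_memLp μ νG k hhc hhs hsymm hreal T hT (𝔥 z) (hsep z hz) Ψ hΨT (hL2 z hz Ψ hΨT)

end Head

end Summit.HodgeConjecture.HodgeConjecture.Cruxes.H413.K2E1ChiEisensteinUniquenessU2
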